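import Summits.QuantumFields.YangMills.Theorems.BalabanUVNodesN15AtKeyedHome
import Summits.QuantumFields.YangMills.Theorems.BalabanUVNodesRateCarriersOfRecord13CoPH

/-!
# Route «BalabanUVNodes», cluster K4 «SpineRates» — node N15 = NE2 AT NODE 00's STAGE-13 v1.7 `CoPH` CANONICAL RATE HOME `RRec₁₃CoPH 𝔯` BY NAME: the two keyed-home
# certificates, the K4 stub `S_N15` from the three NE2⁺ layers, the θ-sufficient form, the consumer faces, the operator layer with the background block LIVE, the
# decided toys WITH RR-1's populatedness display, component locality, pin-meets-estimate

Cell `pub-ymgap`, seat `pub-ymgap-dag-n15-a` (-a KNIT-BY-NAME seat of node N15; HUMAN RULING D-0062; chair R424 venue), generation 14, part 74 (THEOREMS ONLY, 0 `def`,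
0 `sorry`).  `bears_on: R4∕N15 · K3⁷ SpineGivenEndpointR13SepCoPH (stmt-QuantumFields-20544, plan rev 24∕25; dag-lead WORDS-143: rate-record faces → 20544)`.  Filed
`--kind proof --supports stmt-QuantumFields-20544 --as helper` — COUNT-NEUTRAL.

v1.7 `CoPH` EDITION — WHY THIS FILE EXISTS.  N15's home faces stopped at the FIRST Stage-13 edition (part 33 `…N15AtRateRecord13`, p494009, at `RRec₁₃ 𝔯` over the key
`IsDatumOfRecord₁₃C`); the record has since been re-keyed four times (`Co` → `CoP` → v1.6 `CoPR` FINDING №8 → v1.7 `CoPH` FINDING №9 = node00-def-T LOCATED-9 «history-blind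
residual 𝐓-weight slot»: `structure Stage13HParams extends Stage13RParams` with the history-indexed field `Zh`, proviso `Provisos₁₃CoPH`, datum `datumOfRecord₁₃CoPH`, key
`Node00/Record13DatumKeyCoPH` p539151 `IsDatumOfRecord₁₃CCoPH`; director-ym №183 H1ʰ ∕ №186 (α) ∕ №190–№191; dag-lead WORDS-143), and dag-n22-e's (T-RATE) layer B followed
(1″ᶜᵒᵖᴴ `…RateCarriersOfRecord13CoPH`, p541030: `RateReading₁₃CoPH`, `rateCarriersOfRecord₁₃CoPH`, `RRec₁₃CoPH`, `rRec₁₃CoPH_self`, `s_N15_rRec₁₃CoPH_iff`,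
`forall_datumKey₁₃CoPH_of_forall_admissible`; 5″ᶜᵒᵖᴴ `…RateCarriersOfRecord13CoPHOn`, p541389: the `Rg`-guarded tuple-keyed home `RRec₁₃CoPHOn 𝔯 Rg`, `s_N15_rRec₁₃CoPHOn_iff`,
`k4_rRec₁₃CoPHOn_anti`, `k4_rRec₁₃CoPH_of_rRec₁₃CoPHOn_true`, `rRec₁₃CoPHOn_of_regime_params`).  Every other rate slot N14 ∕ N16 ∕ N18 ∕ N22 has its producer face at the
CoPH homes; N15's was the one missing (dag-n27-c `FIELD-TABLE-R13CoPR.md` ∕ `-R13CoPH.md`: «h15 N15 NE2 — n15-a knit-layer twin NOT FILED — displayed (`h15`)» in XL ∕ XLI ∕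
XLIIᶜᵒᵖᴴ and leaf B `…N27SpineGivenEndpointR13SepCoPHHomes`).  THIS FILE is the TOKEN TWIN of part 33 under T₇ ∘ … (`RateReading₁₃ ↦ RateReading₁₃CoPH`,
`rateCarriersOfRecord₁₃ ↦ rateCarriersOfRecord₁₃CoPH`, `RRec₁₃ ↦ RRec₁₃CoPH`, `rRec₁₃_self ↦ rRec₁₃CoPH_self`, `IsDatumOfRecord₁₃C ↦ IsDatumOfRecord₁₃CCoPH`, binder
`Stage13Params ↦ Stage13HParams`, `Provisos₁₃ ↦ Provisos₁₃CoPH`, `forall_datumKey₁₃_of_forall_admissible ↦ forall_datumKey₁₃CoPH_of_forall_admissible`) — statements = part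
33's under the map, proofs VERBATIM (every one an instance of this seat's STAGE-GENERIC keyed-home interface part 30 `…N15AtKeyedHome`, p465385, whose key type, reading and
home are variables — no port of it is ever needed); the `Rg`-GUARDED tuple-keyed home `RRec₁₃CoPHOn 𝔯 Rg` the K3⁷ composer also reads is the companion part 74b
`…N15AtRRec13CoPHOn` (400-line cap).  N15 reads NO field of the key (no `Zh ∕ Zr ∕ Zt`, no `bg`, no transport face — T₇'s SITE RULE has no site here), which is why the port is a token map.
The ₁₃ ∕ ₁₂ ∕ ₁₁ editions (parts 33 ∕ 31 ∕ 29) stay as the aside items' context; nothing landed is edited or re-declared.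

CONTENTS.  §1 certificates `admits_rRec₁₃CoPH_ne2` ∕ `attains_rRec₁₃CoPH_ne2`, `s_N15_rRec₁₃CoPH_iff_keyed` (= layer B's `s_N15_rRec₁₃CoPH_iff`), `rateCarriersOfRecord₁₃CoPH_ne2`
(`rfl`), `n15At_rateCarriersOfRecord₁₃CoPH_of_ratesAt`.  §2 THE K4 STUB AT THE CANONICAL HOME: `s_N15_rRec₁₃CoPH_of_layers`, `n15At_rateCarriersOfRecord₁₃CoPH_of_forall_admissible`,
★ **`s_N15_rRec₁₃CoPH_of_forall_admissible`** (the θ-sufficient `h15`), `s_N15_rRec₁₃CoPH_of_layers_forall_admissible`; faces `n15At_rRec₁₃CoPH`, `ne2PlusOperator_rRec₁₃CoPH`,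
`ne2PlusSite_rRec₁₃CoPH`, `ne2PlusUnit_rRec₁₃CoPH`; `s_N15_rRec₁₃CoPH_of_background₁` (operator layer with the background block LIVE — dag-n15-c's first-order family).  §3 decided
toys with the populatedness display: `exists_reading₁₃CoPH_ne2_const`, `s_N15_rRec₁₃CoPH_of_emptyIndexReading`, `exists_reading_s_N15_rRec₁₃CoPH_vacuous` (¬`Populated`),
`s_N15_rRec₁₃CoPH_of_knitReading` ∕ `exists_reading_s_N15_rRec₁₃CoPH_knit` ∕ `…_knit_family` (LG-vector knit reading: hypothesis-free, `Populated`),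
`not_s_N15_rRec₁₃CoPH_of_ratelessReading` ∕ `exists_reading_not_s_N15_rRec₁₃CoPH`, `s_N15_rRec₁₃CoPH_decided_by_pin`.  §4 component locality: `s_N15_rRec₁₃CoPH_of_ne2_agree`,
`s_N15_rRec₁₃CoPH_iff_of_ne2_agree`, ★ `s_N15_rRec₁₃CoPH_of_pin`.  The guarded home is part 74b's; the GENUINE `U ≡ 1` family's readings (part 73
`…N15FullPropagatorGenuineN15At`) and the reading of record `readingOfRecord₁₃CoPH w1 ℓ₃ ne2 ne1` (6″ᶜᵒᵖᴴ) are part 75's.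

HONEST FRAMING.  Kernel bookkeeping BY NAME at the Stage-13 v1.7 homes; no estimate is proved here; the readings `𝔯` are PARAMETERS — the objects of record for `𝔯.lit · ne2`
(Bałaban's run-indexed paired instances with backgrounds LIVE: the η-pairing of Node 00's [B9] letters) are NOT pinned by any definer; the hypothesis-free inhabitant
(§3 knit) is the `U ≡ 1` LG-vector torus MODEL; no admissible Stage-13 tuple with provisos is claimed to exist (K0⁷ `Record13SepCoPHInhabited`, stmt-QuantumFields-20541,
OPEN — where none exists `S_N15 (RRec₁₃CoPH 𝔯)` is vacuous, §3); NE2⁺ NOT PRINTED beyond King's scalar template; **N15 is NOT discharged**;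
count-neutral (typed 28∕28 · discharged 5∕27 of record unchanged); one finite four-torus at fixed ε — NOT ℝ⁴, NOT infinite volume, NOT OS, NOT a mass gap, NOT Clay.
Restate-immune (no Theses import).  No decl below carries a cite tag.
-/

set_option autoImplicit false

noncomputable section
namespace Summit.QuantumFields.YangMills.BalabanUVNodes.N15.AtRRec13CoPH

open Literature.MathematicalPhysics.QuantumFieldTheory.Balaban1983to89
open Literature.MathematicalPhysics.QuantumFieldTheory.Balaban1983to89.T4Continuum (T4Family ULoop)
open Literature.MathematicalPhysics.QuantumFieldTheory.Balaban1983to89.T4EtaRate (PairedInstance NE2PlusOperator NE2PlusSite NE2PlusUnit)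
open Literature.MathematicalPhysics.QuantumFieldTheory.Balaban1983to89.NE2NodeTorus (KnitIndex knitInstance knitOp knitOp166 knitSite163 covOpKernels
  inAll rhoDist)
open Node00 (IsDatumOfRecord₁₃CCoPH Stage13HParams NE2Objects₁₁ RateObjects₁₁ nonempty_rateObjects₁₁ datumOfRecord₁₃CoPH)
open Summit.QuantumFields.YangMills.Theorems.BalabanUVNodesN15Knit (not_N15op_rateless N15_with_zero_layers_dim4)
open Summit.QuantumFields.YangMills.BalabanUVNodes.N15.VectorPiece (VecIndexS bgVecInstance₁ bgVecFamily₁4)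
open Summit.QuantumFields.YangMills.BalabanUVNodes.N15.AtKeyedHome (s_N15_of_admits s_N15_iff_of_admits_attains s_N15_of_admits_layers n15At_of_attains
  s_N15_of_admits_background₁ s_N15_of_admits_emptyIndex s_N15_of_admits_knit s_N15_of_admits_knit_family populated_knitObjects not_populated_emptyIndexObjects
  s_N15_of_admits_attains_ne2_agree s_N15_of_admits_pin neZero_blockFactor)
open YMDAG.UVSplit (Datum NE1pCarriers NE2Carriers RateCarriers RateRecordPred N15At RatesAt S_N15 ne2OfRecord₁₁ RateReading₁₃CoPH rateCarriersOfRecord₁₃CoPH RRec₁₃CoPH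
  forall_datumKey₁₃CoPH_of_forall_admissible)

variable {N : ℕ} [NeZero N]

/-! ## §1 The Stage-13 certificates and the bundle's NE2 component -/

/-- **`RRec₁₃CoPH 𝔯` ADMITS only the NE2 literals of its reading** (`key := IsDatumOfRecord₁₃CCoPH`, `ne2At h g₀ os k := (𝔯.lit F h.params h.provisos g₀ os).ne2 k`;
`rfl` on the bundle's second component). [bookkeeping] -/
theorem admits_rRec₁₃CoPH_ne2 (𝔯 : RateReading₁₃CoPH N) (F : T4Family) (D : Datum F N) (g₀ : ℕ → ℝ) (os : List (ULoop F)) (R : RateCarriers N)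
    (hR : RRec₁₃CoPH 𝔯 F D g₀ os R) :
    ∃ (h : IsDatumOfRecord₁₃CCoPH F N D) (k : ℕ), R.ne2 = ne2OfRecord₁₁ ((𝔯.lit F h.params h.provisos g₀ os).ne2 k) := by
  obtain ⟨h, k, rfl⟩ := hR
  exact ⟨h, k, rfl⟩

/-- **`RRec₁₃CoPH 𝔯` ATTAINS every NE2 literal of its reading** (witness: the run-length-`k` bundle, layer B's `rRec₁₃CoPH_self`). [bookkeeping] -/
theorem attains_rRec₁₃CoPH_ne2 (𝔯 : RateReading₁₃CoPH N) (F : T4Family) (D : Datum F N) (h : IsDatumOfRecord₁₃CCoPH F N D) (g₀ : ℕ → ℝ) (os : List (ULoop F))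
    (k : ℕ) : ∃ R : RateCarriers N, RRec₁₃CoPH 𝔯 F D g₀ os R ∧ R.ne2 = ne2OfRecord₁₁ ((𝔯.lit F h.params h.provisos g₀ os).ne2 k) :=
  ⟨rateCarriersOfRecord₁₃CoPH 𝔯 F h.params h.provisos g₀ os k, ⟨h, k, rfl⟩, rfl⟩

/-- **CERTIFICATE CHECK**: the keyed `iff` at the Stage-13 instance IS layer B's face `s_N15_rRec₁₃CoPH_iff` (same statement, from the two certificates). [bookkeeping] -/
theorem s_N15_rRec₁₃CoPH_iff_keyed (𝔯 : RateReading₁₃CoPH N) :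
    S_N15 (RRec₁₃CoPH 𝔯) ↔ ∀ (F : T4Family) (D : Datum F N) (h : IsDatumOfRecord₁₃CCoPH F N D) (g₀ : ℕ → ℝ) (os : List (ULoop F)) (k : ℕ),
      N15At (ne2OfRecord₁₁ ((𝔯.lit F h.params h.provisos g₀ os).ne2 k)) :=
  s_N15_iff_of_admits_attains (key := fun F D => IsDatumOfRecord₁₃CCoPH F N D) (fun {F D} (h : IsDatumOfRecord₁₃CCoPH F N D) g₀ os k =>
      (𝔯.lit F h.params h.provisos g₀ os).ne2 k) (RRec₁₃CoPH 𝔯)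
    (admits_rRec₁₃CoPH_ne2 𝔯) (attains_rRec₁₃CoPH_ne2 𝔯)

/-- The NE2 component of the Stage-13 bundle of record at run length `k` IS the home's NE2 bundle of the reading's level-`k` NE2 objects (`rfl`). [bookkeeping] -/
theorem rateCarriersOfRecord₁₃CoPH_ne2 (𝔯 : RateReading₁₃CoPH N) (F : T4Family) (θ : Stage13HParams F N) (hP : θ.Provisos₁₃CoPH F N) (g₀ : ℕ → ℝ)
    (os : List (ULoop F)) (k : ℕ) : (rateCarriersOfRecord₁₃CoPH 𝔯 F θ hP g₀ os k).ne2 = ne2OfRecord₁₁ ((𝔯.lit F θ hP g₀ os).ne2 k) :=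
  rfl

/-- K4's per-string conclusion `RatesAt D R` at a Stage-13 bundle of record carries N15 at the home's NE2 bundle. [bookkeeping] -/
theorem n15At_rateCarriersOfRecord₁₃CoPH_of_ratesAt (𝔯 : RateReading₁₃CoPH N) {F : T4Family} {D : Datum F N} (θ : Stage13HParams F N)
    (hP : θ.Provisos₁₃CoPH F N) (g₀ : ℕ → ℝ) (os : List (ULoop F)) (k : ℕ) (h : RatesAt D (rateCarriersOfRecord₁₃CoPH 𝔯 F θ hP g₀ os k)) :
    N15At (ne2OfRecord₁₁ ((𝔯.lit F θ hP g₀ os).ne2 k)) :=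
  h.2.1

/-! ## §2 The K4 stub at the Stage-13 home -/

/-- **THE K4 STUB AT THE HOME, CLOSED FROM THE THREE LAYERS IN ONE APPLICATION.**  If at every family, every Stage-13 datum of record `D` (key `h`), every
`(g₀, os)` and every run length `k` the reading's NE2 objects `o := (𝔯.lit F h.params h.provisos g₀ os).ne2 k` carry the operator, site-kernel (`d = 4`) and
unit-lattice layers, then `S_N15 (RRec₁₃CoPH 𝔯)` (file 1's `s_N15_of_admits_layers` at the certificate).  Nothing here is an estimate. [bookkeeping] -/
theorem s_N15_rRec₁₃CoPH_of_layers (𝔯 : RateReading₁₃CoPH N)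
    (h : ∀ (F : T4Family) (D : Datum F N) (h : IsDatumOfRecord₁₃CCoPH F N D) (g₀ : ℕ → ℝ) (os : List (ULoop F)) (k : ℕ),
      NE2PlusOperator ((𝔯.lit F h.params h.provisos g₀ os).ne2 k).c35 ((𝔯.lit F h.params h.provisos g₀ os).ne2 k).pi
          ((𝔯.lit F h.params h.provisos g₀ os).ne2 k).Kop ∧
      NE2PlusSite 4 ((𝔯.lit F h.params h.provisos g₀ os).ne2 k).p ((𝔯.lit F h.params h.provisos g₀ os).ne2 k).c35
          ((𝔯.lit F h.params h.provisos g₀ os).ne2 k).pi ((𝔯.lit F h.params h.provisos g₀ os).ne2 k).Ksite ∧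
      NE2PlusUnit ((𝔯.lit F h.params h.provisos g₀ os).ne2 k).c35 ((𝔯.lit F h.params h.provisos g₀ os).ne2 k).pi
          ((𝔯.lit F h.params h.provisos g₀ os).ne2 k).Kunit ((𝔯.lit F h.params h.provisos g₀ os).ne2 k).inΛ
          ((𝔯.lit F h.params h.provisos g₀ os).ne2 k).unitDist) :
    S_N15 (RRec₁₃CoPH 𝔯) :=
  s_N15_of_admits_layers (fun {F D} (h : IsDatumOfRecord₁₃CCoPH F N D) g₀ os k =>
      (𝔯.lit F h.params h.provisos g₀ os).ne2 k) (RRec₁₃CoPH 𝔯) (admits_rRec₁₃CoPH_ne2 𝔯) h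

/-- **N15 AT EVERY STAGE-13 BUNDLE OF THE READING FROM THE θ-FORM** — if `N15At` holds at the reading's NE2 objects for EVERY `θ : Stage13HParams F N` with
provisos `hP` and `θ.Admissible F N`, along every `(g₀, os, k)`, then it holds at the NE2 component of every bundle `rateCarriersOfRecord₁₃CoPH 𝔯 F θ hP g₀ os k` on
that class (`rfl` on the component).  The Stage-13 items quantify over the NARROWER unity class `θ.ZtUnity → θ.Admissible F N → …` (director LINE №99); a K4 join
there reads this face a fortiori. [bookkeeping] -/
theorem n15At_rateCarriersOfRecord₁₃CoPH_of_forall_admissible (𝔯 : RateReading₁₃CoPH N)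
    (h : ∀ (F : T4Family) (θ : Stage13HParams F N) (hP : θ.Provisos₁₃CoPH F N), θ.Admissible F N → ∀ (g₀ : ℕ → ℝ) (os : List (ULoop F)) (k : ℕ),
      N15At (ne2OfRecord₁₁ ((𝔯.lit F θ hP g₀ os).ne2 k)))
    (F : T4Family) (θ : Stage13HParams F N) (hP : θ.Provisos₁₃CoPH F N) (hA : θ.Admissible F N) (g₀ : ℕ → ℝ) (os : List (ULoop F)) (k : ℕ) :
    N15At (rateCarriersOfRecord₁₃CoPH 𝔯 F θ hP g₀ os k).ne2 :=
  h F θ hP hA g₀ os k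

/-- **THE θ-SUFFICIENT FORM OF THE KNIT** — what a prover of the pin discharges, with no canonical parameter in sight: `N15At` at the home's NE2 bundle of the
reading for EVERY `θ : Stage13HParams F N` with provisos and `θ.Admissible F N`, along every `(g₀, os, k)`; layer B's `forall_datumKey₁₃CoPH_of_forall_admissible`
transports it to the datum keys.  This is the `h15` the K4 join consumes at the home. [bookkeeping] -/
theorem s_N15_rRec₁₃CoPH_of_forall_admissible (𝔯 : RateReading₁₃CoPH N)
    (h : ∀ (F : T4Family) (θ : Stage13HParams F N) (hP : θ.Provisos₁₃CoPH F N), θ.Admissible F N → ∀ (g₀ : ℕ → ℝ) (os : List (ULoop F)) (k : ℕ),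
      N15At (ne2OfRecord₁₁ ((𝔯.lit F θ hP g₀ os).ne2 k))) :
    S_N15 (RRec₁₃CoPH 𝔯) :=
  (s_N15_rRec₁₃CoPH_iff_keyed 𝔯).2
    (forall_datumKey₁₃CoPH_of_forall_admissible (P := fun F _ θ hP g₀ os k => N15At (ne2OfRecord₁₁ ((𝔯.lit F θ hP g₀ os).ne2 k)))
      fun F θ hP hA g₀ os k => h F θ hP hA g₀ os k)

/-- **THE θ-SUFFICIENT FORM, LAYERS SPELLED OUT**: the three NE2⁺ layers at the reading's NE2 objects for every `θ` with provisos and admissibility ⇒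
`S_N15 (RRec₁₃CoPH 𝔯)`. [bookkeeping] -/
theorem s_N15_rRec₁₃CoPH_of_layers_forall_admissible (𝔯 : RateReading₁₃CoPH N)
    (h : ∀ (F : T4Family) (θ : Stage13HParams F N) (hP : θ.Provisos₁₃CoPH F N), θ.Admissible F N → ∀ (g₀ : ℕ → ℝ) (os : List (ULoop F)) (k : ℕ),
      NE2PlusOperator ((𝔯.lit F θ hP g₀ os).ne2 k).c35 ((𝔯.lit F θ hP g₀ os).ne2 k).pi ((𝔯.lit F θ hP g₀ os).ne2 k).Kop ∧
      NE2PlusSite 4 ((𝔯.lit F θ hP g₀ os).ne2 k).p ((𝔯.lit F θ hP g₀ os).ne2 k).c35 ((𝔯.lit F θ hP g₀ os).ne2 k).pi ((𝔯.lit F θ hP g₀ os).ne2 k).Ksite ∧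
      NE2PlusUnit ((𝔯.lit F θ hP g₀ os).ne2 k).c35 ((𝔯.lit F θ hP g₀ os).ne2 k).pi ((𝔯.lit F θ hP g₀ os).ne2 k).Kunit ((𝔯.lit F θ hP g₀ os).ne2 k).inΛ
        ((𝔯.lit F θ hP g₀ os).ne2 k).unitDist) :
    S_N15 (RRec₁₃CoPH 𝔯) :=
  s_N15_rRec₁₃CoPH_of_forall_admissible 𝔯 fun F θ hP hA g₀ os k => (AtRateRecord11.n15At_ne2OfRecord₁₁_iff _).2 (h F θ hP hA g₀ os k)

section Faces

variable (𝔯 : RateReading₁₃CoPH N) (hS : S_N15 (RRec₁₃CoPH 𝔯)) (F : T4Family) (D : Datum F N) (hD : IsDatumOfRecord₁₃CCoPH F N D) (g₀ : ℕ → ℝ)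
  (os : List (ULoop F)) (k : ℕ)
include hS

/-- **WHAT THE STUB AT THE HOME DELIVERS**: N15 at the NE2 component of the BUNDLE OF RECORD `rateCarriersOfRecord₁₃CoPH 𝔯 …` of every Stage-13 datum key, `(g₀, os)` and run length. [bookkeeping] -/
theorem n15At_rRec₁₃CoPH : N15At (rateCarriersOfRecord₁₃CoPH 𝔯 F hD.params hD.provisos g₀ os k).ne2 :=
  n15At_of_attains (fun {F D} (h : IsDatumOfRecord₁₃CCoPH F N D) g₀ os k =>
      (𝔯.lit F h.params h.provisos g₀ os).ne2 k) (RRec₁₃CoPH 𝔯) (attains_rRec₁₃CoPH_ne2 𝔯) hS F D hD g₀ os k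

/-- Consumer face: the OPERATOR layer at the reading's NE2 objects of a Stage-13 datum key. [bookkeeping] -/
theorem ne2PlusOperator_rRec₁₃CoPH :
    NE2PlusOperator (rateCarriersOfRecord₁₃CoPH 𝔯 F hD.params hD.provisos g₀ os k).ne2.c35 (rateCarriersOfRecord₁₃CoPH 𝔯 F hD.params hD.provisos g₀ os k).ne2.pi
      (rateCarriersOfRecord₁₃CoPH 𝔯 F hD.params hD.provisos g₀ os k).ne2.Kop :=
  (n15At_rRec₁₃CoPH 𝔯 hS F D hD g₀ os k).1

/-- Consumer face: the SITE-KERNEL layer (`d = 4`) at the reading's NE2 objects of a Stage-13 datum key. [bookkeeping] -/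
theorem ne2PlusSite_rRec₁₃CoPH :
    NE2PlusSite 4 (rateCarriersOfRecord₁₃CoPH 𝔯 F hD.params hD.provisos g₀ os k).ne2.p (rateCarriersOfRecord₁₃CoPH 𝔯 F hD.params hD.provisos g₀ os k).ne2.c35
      (rateCarriersOfRecord₁₃CoPH 𝔯 F hD.params hD.provisos g₀ os k).ne2.pi (rateCarriersOfRecord₁₃CoPH 𝔯 F hD.params hD.provisos g₀ os k).ne2.Ksite :=
  (n15At_rRec₁₃CoPH 𝔯 hS F D hD g₀ os k).2.1

/-- Consumer face: the UNIT-LATTICE layer at the reading's NE2 objects of a Stage-13 datum key. [bookkeeping] -/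
theorem ne2PlusUnit_rRec₁₃CoPH :
    NE2PlusUnit (rateCarriersOfRecord₁₃CoPH 𝔯 F hD.params hD.provisos g₀ os k).ne2.c35 (rateCarriersOfRecord₁₃CoPH 𝔯 F hD.params hD.provisos g₀ os k).ne2.pi
      (rateCarriersOfRecord₁₃CoPH 𝔯 F hD.params hD.provisos g₀ os k).ne2.Kunit (rateCarriersOfRecord₁₃CoPH 𝔯 F hD.params hD.provisos g₀ os k).ne2.inΛ
      (rateCarriersOfRecord₁₃CoPH 𝔯 F hD.params hD.provisos g₀ os k).ne2.unitDist :=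
  (n15At_rRec₁₃CoPH 𝔯 hS F D hD g₀ os k).2.2

end Faces

/-- **THE OPERATOR LAYER WITH THE BACKGROUND BLOCK LIVE, AT THE STAGE-13 HOME.**  For `d + 1 ≥ 2` and `L ≥ 1`: if at every Stage-13 datum of record, `(g₀, os)`
and run length the reading's NE2 objects ARE dag-n15-c's FIRST-ORDER background-live vector-piece carriers (index `VecIndexS d L`, instances
`VectorPiece.bgVecInstance₁ L hL` — (3.35) letter pair with the index's own `M`, guard LIVE —, the CONSTRUCTED operator kernels `VectorPiece.bgVecFamily₁4 L hL`, any
`c35 > 0`, `p`, site ∕ unit kernels, region, unit distance) together with the SITE and UNIT layers on them, then `S_N15 (RRec₁₃CoPH 𝔯)` — the operator conjunct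
is the producer's theorem `VectorPiece.ne2PlusOperator_vectorPiece_background₁`, NOT a hypothesis (file 1's `s_N15_of_admits_background₁`).  Honest scope: the
LINEAR (`U = 1`) vector single-scale piece dressed by the ABELIAN first-order species — NOT Bałaban's `G(U)`. [bookkeeping] -/
theorem s_N15_rRec₁₃CoPH_of_background₁ {d L : ℕ} [NeZero L] (hd : 1 ≤ d) (hL : 1 ≤ L) (𝔯 : RateReading₁₃CoPH N)
    (h : ∀ (F : T4Family) (D : Datum F N) (hD : IsDatumOfRecord₁₃CCoPH F N D) (g₀ : ℕ → ℝ) (os : List (ULoop F)) (k : ℕ),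
      ∃ (c35 p : ℝ) (Ksite Kunit : ∀ j : VecIndexS d L, B9.SiteKernel (bgVecInstance₁ (d := d) L hL j).gc (bgVecInstance₁ (d := d) L hL j).Bf)
        (inΛ : ∀ j : VecIndexS d L, (bgVecInstance₁ (d := d) L hL j).gc.Site → Prop)
        (unitDist : ∀ j : VecIndexS d L, (bgVecInstance₁ (d := d) L hL j).gc.Site → (bgVecInstance₁ (d := d) L hL j).gc.Site → ℝ),
        0 < c35 ∧
        (𝔯.lit F hD.params hD.provisos g₀ os).ne2 k =
          { I := VecIndexS d L, c35 := c35, p := p, pi := bgVecInstance₁ (d := d) L hL, Kop := bgVecFamily₁4 (d := d) L hL,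
            Ksite := Ksite, Kunit := Kunit, inΛ := inΛ, unitDist := unitDist } ∧
        NE2PlusSite 4 p c35 (bgVecInstance₁ (d := d) L hL) Ksite ∧ NE2PlusUnit c35 (bgVecInstance₁ (d := d) L hL) Kunit inΛ unitDist) :
    S_N15 (RRec₁₃CoPH 𝔯) :=
  s_N15_of_admits_background₁ (fun {F D} (h : IsDatumOfRecord₁₃CCoPH F N D) g₀ os k =>
      (𝔯.lit F h.params h.provisos g₀ os).ne2 k) (RRec₁₃CoPH 𝔯) hd hL (admits_rRec₁₃CoPH_ne2 𝔯) h

/-! ## §3 The decided toys at the Stage-13 home, with the populatedness display: the pin of `𝔯.lit · ne2` decides -/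

/-- **THE STAGE-13 READING TYPE ADMITS CONSTANT NE2 OBJECTS** (any `o`; U3 ∕ NE3 components from RR-1's `Node00.nonempty_rateObjects₁₁`, the dressed-tower component
an EMPTY tower of no content) — so every toy below is realised by SOME reading. [bookkeeping] -/
theorem exists_reading₁₃CoPH_ne2_const (o : NE2Objects₁₁) :
    ∃ 𝔯 : RateReading₁₃CoPH N, ∀ (F : T4Family) (θ : Stage13HParams F N) (hP : θ.Provisos₁₃CoPH F N) (g₀ : ℕ → ℝ) (os : List (ULoop F)) (k : ℕ),
      (𝔯.lit F θ hP g₀ os).ne2 k = o := by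
  obtain ⟨r₀⟩ := nonempty_rateObjects₁₁ (N := N)
  exact ⟨⟨fun _ _ _ _ _ => ⟨r₀.u3, r₀.ne3, fun _ => o⟩,
    fun _ _ _ _ _ => (⟨Empty, ⟨fun q => q.elim, fun q => q.elim, fun q => q.elim⟩, 0⟩ : NE1pCarriers)⟩, fun _ _ _ _ _ _ => rfl⟩

/-- **A2 TRAP AT THE STAGE-13 HOME — A READING WITHOUT PAIRED INSTANCES HAS `S_N15 (RRec₁₃CoPH 𝔯)` WITH NO ESTIMATE** [decided toy]: if every NE2 object of the reading
(all families, Stage-13 parameters with provisos, `(g₀, os)`, run lengths) has an EMPTY index of paired instances, the stub at the home holds vacuously (file 1's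
`s_N15_of_admits_emptyIndex` at the certificate).  Reading for the PIN: `I` = Bałaban's run-indexed pairs of scales, INHABITED. [bookkeeping] -/
theorem s_N15_rRec₁₃CoPH_of_emptyIndexReading (𝔯 : RateReading₁₃CoPH N)
    (h : ∀ (F : T4Family) (θ : Stage13HParams F N) (hP : θ.Provisos₁₃CoPH F N) (g₀ : ℕ → ℝ) (os : List (ULoop F)) (k : ℕ),
      IsEmpty ((𝔯.lit F θ hP g₀ os).ne2 k).I) :
    S_N15 (RRec₁₃CoPH 𝔯) :=
  s_N15_of_admits_emptyIndex (fun {F D} (h : IsDatumOfRecord₁₃CCoPH F N D) g₀ os k =>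
      (𝔯.lit F h.params h.provisos g₀ os).ne2 k) (RRec₁₃CoPH 𝔯) (admits_rRec₁₃CoPH_ne2 𝔯)
    fun F _ hD g₀ os k => h F hD.params hD.provisos g₀ os k

/-- **SOME READING CLOSES THE STUB AT THE HOME WITH NO CONTENT — AND RR-1's DISPLAY CATCHES IT** [decided toy]: the constant reading at the NE2 objects with the
EMPTY index (no paired instance, no kernel) has `S_N15 (RRec₁₃CoPH 𝔯)`, and its NE2 objects are NOWHERE `Populated` (file 1's `not_populated_emptyIndexObjects`) —
the vacuous corner is exactly the one the populatedness display excludes (dag-ref-H (A1)). [bookkeeping] -/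
theorem exists_reading_s_N15_rRec₁₃CoPH_vacuous :
    ∃ 𝔯 : RateReading₁₃CoPH N,
      (∀ (F : T4Family) (θ : Stage13HParams F N) (hP : θ.Provisos₁₃CoPH F N) (g₀ : ℕ → ℝ) (os : List (ULoop F)) (k : ℕ),
        ¬ ((𝔯.lit F θ hP g₀ os).ne2 k).Populated) ∧
      S_N15 (RRec₁₃CoPH 𝔯) := by
  obtain ⟨𝔯, h𝔯⟩ := exists_reading₁₃CoPH_ne2_const (N := N)
    { I := PEmpty, c35 := 0, p := 0, pi := PEmpty.elim, Kop := fun i => i.elim, Ksite := fun i => i.elim, Kunit := fun i => i.elim,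
      inΛ := fun i => i.elim, unitDist := fun i => i.elim }
  refine ⟨𝔯, fun F θ hP g₀ os k => ?_, s_N15_rRec₁₃CoPH_of_emptyIndexReading 𝔯 fun F θ hP g₀ os k => ?_⟩
  · rw [h𝔯 F θ hP g₀ os k]
    exact not_populated_emptyIndexObjects 0 0
  · rw [h𝔯 F θ hP g₀ os k]
    exact (inferInstance : IsEmpty PEmpty)

/-- **THE LG-VECTOR KNIT READING CLOSES THE STUB AT THE STAGE-13 HOME, HYPOTHESIS-FREE AND NON-DEGENERATE** [decided toy].  For every block factor `L ≥ 2`,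
directions `μ ≠ ν`, labels `a b μ′ λ α β`, letters `c35`, `p`: if at every Stage-13 datum of record, `(g₀, os)` and run length the reading's NE2 objects are the KNIT
CARRIERS of this lineage's `U ≡ 1` Landau-gauge vector linear theory on the four-dimensional unit tori (index `KnitIndex 3 L` — INHABITED —, instances
`knitInstance 3 L`, kernels `knitOp166 L μ ν a b` = Δ_k (1.66), `knitSite163 L μ′ λ` = H_k (1.63), `covOpKernels L α β` = C^{(k)} (2.156), `inAll`, `rhoDist`),
then `S_N15 (RRec₁₃CoPH 𝔯)` by `N15Knit.N15_with_zero_layers_dim4` (King's γ = 2 ∕ γ = 1 ∕ θ = L⁻¹; rates, decay and index-uniformity genuine) — file 1's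
`s_N15_of_admits_knit` at the certificate.  A MODEL-level inhabitant: NOT Bałaban's multiscale `G(U)`. [bookkeeping] -/
theorem s_N15_rRec₁₃CoPH_of_knitReading (L : ℕ) [NeZero L] (hL : 2 ≤ L) {μ ν : Fin 4} (hμν : μ ≠ ν) (a b μ' lam α β : Fin 4) (c35 p : ℝ)
    (𝔯 : RateReading₁₃CoPH N)
    (h : ∀ (F : T4Family) (D : Datum F N) (hD : IsDatumOfRecord₁₃CCoPH F N D) (g₀ : ℕ → ℝ) (os : List (ULoop F)) (k : ℕ),
      (𝔯.lit F hD.params hD.provisos g₀ os).ne2 k =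
        { I := KnitIndex 3 L, c35 := c35, p := p, pi := knitInstance 3 L, Kop := knitOp166 L μ ν a b, Ksite := knitSite163 L μ' lam,
          Kunit := covOpKernels L α β, inΛ := inAll L, unitDist := rhoDist L }) :
    S_N15 (RRec₁₃CoPH 𝔯) :=
  s_N15_of_admits_knit (fun {F D} (h : IsDatumOfRecord₁₃CCoPH F N D) g₀ os k =>
      (𝔯.lit F h.params h.provisos g₀ os).ne2 k) (RRec₁₃CoPH 𝔯) L hL hμν a b μ' lam α β c35 p (admits_rRec₁₃CoPH_ne2 𝔯) h

/-- **SUCH A READING EXISTS — SOME READING CLOSES THE STUB AT THE HOME OUTRIGHT ON AN INHABITED FAMILY WITH GENUINE RATES, POPULATED EVERYWHERE** [decided toy,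
non-degenerate]: the constant reading at the knit carriers (any `L ≥ 2`, `μ ≠ ν`, labels, `c35`, `p`); its NE2 objects are DISPLAYED, `Populated` at every tuple
(RR-1 §8), and `S_N15 (RRec₁₃CoPH 𝔯)` holds with no hypothesis. [bookkeeping] -/
theorem exists_reading_s_N15_rRec₁₃CoPH_knit (L : ℕ) [NeZero L] (hL : 2 ≤ L) {μ ν : Fin 4} (hμν : μ ≠ ν) (a b μ' lam α β : Fin 4) (c35 p : ℝ) :
    ∃ 𝔯 : RateReading₁₃CoPH N,
      (∀ (F : T4Family) (θ : Stage13HParams F N) (hP : θ.Provisos₁₃CoPH F N) (g₀ : ℕ → ℝ) (os : List (ULoop F)) (k : ℕ),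
        (𝔯.lit F θ hP g₀ os).ne2 k =
          { I := KnitIndex 3 L, c35 := c35, p := p, pi := knitInstance 3 L, Kop := knitOp166 L μ ν a b, Ksite := knitSite163 L μ' lam,
            Kunit := covOpKernels L α β, inΛ := inAll L, unitDist := rhoDist L }) ∧
      (∀ (F : T4Family) (θ : Stage13HParams F N) (hP : θ.Provisos₁₃CoPH F N) (g₀ : ℕ → ℝ) (os : List (ULoop F)) (k : ℕ),
        ((𝔯.lit F θ hP g₀ os).ne2 k).Populated) ∧
      S_N15 (RRec₁₃CoPH 𝔯) := by
  obtain ⟨𝔯, h𝔯⟩ := exists_reading₁₃CoPH_ne2_const (N := N)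
    { I := KnitIndex 3 L, c35 := c35, p := p, pi := knitInstance 3 L, Kop := knitOp166 L μ ν a b, Ksite := knitSite163 L μ' lam,
      Kunit := covOpKernels L α β, inΛ := inAll L, unitDist := rhoDist L }
  refine ⟨𝔯, h𝔯, fun F θ hP g₀ os k => ?_,
    s_N15_rRec₁₃CoPH_of_knitReading L hL hμν a b μ' lam α β c35 p 𝔯 fun F D hD g₀ os k => h𝔯 F hD.params hD.provisos g₀ os k⟩
  rw [h𝔯 F θ hP g₀ os k]
  exact populated_knitObjects L μ ν a b μ' lam α β c35 p

/-- **THE FAMILY-KEYED KNIT READING EXISTS AND CLOSES THE STUB AT THE HOME, HYPOTHESIS-FREE** [decided toy, non-degenerate, datum-reading]: the reading whose NE2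
objects at `(F, θ, hP, g₀, os, k)` are the knit carriers at the family's OWN block factor `L := F.L` (`AtKeyedHome.neZero_blockFactor F`; `2 ≤ F.L` from the
family's `11 < L`) — so the paired instances' geometry READS the datum's family —; `Populated` everywhere; `S_N15 (RRec₁₃CoPH 𝔯)` by file 1's
`s_N15_of_admits_knit_family`.  Still the `U ≡ 1` torus MODEL, not Bałaban's `G(U)`. [bookkeeping] -/
theorem exists_reading_s_N15_rRec₁₃CoPH_knit_family {μ ν : Fin 4} (hμν : μ ≠ ν) (a b μ' lam α β : Fin 4) (c35 p : ℝ) :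
    ∃ 𝔯 : RateReading₁₃CoPH N,
      (∀ (F : T4Family) (θ : Stage13HParams F N) (hP : θ.Provisos₁₃CoPH F N) (g₀ : ℕ → ℝ) (os : List (ULoop F)) (k : ℕ),
        (𝔯.lit F θ hP g₀ os).ne2 k =
          haveI := neZero_blockFactor F
          { I := KnitIndex 3 F.L, c35 := c35, p := p, pi := knitInstance 3 F.L, Kop := knitOp166 F.L μ ν a b, Ksite := knitSite163 F.L μ' lam,
            Kunit := covOpKernels F.L α β, inΛ := inAll F.L, unitDist := rhoDist F.L }) ∧
      (∀ (F : T4Family) (θ : Stage13HParams F N) (hP : θ.Provisos₁₃CoPH F N) (g₀ : ℕ → ℝ) (os : List (ULoop F)) (k : ℕ),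
        ((𝔯.lit F θ hP g₀ os).ne2 k).Populated) ∧
      S_N15 (RRec₁₃CoPH 𝔯) := by
  obtain ⟨r₀⟩ := nonempty_rateObjects₁₁ (N := N)
  let lit : (F : T4Family) → (θ : Stage13HParams F N) → θ.Provisos₁₃CoPH F N → (ℕ → ℝ) → List (ULoop F) → RateObjects₁₁ N :=
    fun F _ _ _ _ =>
      ⟨r₀.u3, r₀.ne3, fun _ =>
        haveI := neZero_blockFactor F
        { I := KnitIndex 3 F.L, c35 := c35, p := p, pi := knitInstance 3 F.L, Kop := knitOp166 F.L μ ν a b, Ksite := knitSite163 F.L μ' lam,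
          Kunit := covOpKernels F.L α β, inΛ := inAll F.L, unitDist := rhoDist F.L }⟩
  let 𝔯 : RateReading₁₃CoPH N := ⟨lit, fun _ _ _ _ _ => (⟨Empty, ⟨fun q => q.elim, fun q => q.elim, fun q => q.elim⟩, 0⟩ : NE1pCarriers)⟩
  have h𝔯 : ∀ (F : T4Family) (θ : Stage13HParams F N) (hP : θ.Provisos₁₃CoPH F N) (g₀ : ℕ → ℝ) (os : List (ULoop F)) (k : ℕ),
      (𝔯.lit F θ hP g₀ os).ne2 k =
        haveI := neZero_blockFactor F
        { I := KnitIndex 3 F.L, c35 := c35, p := p, pi := knitInstance 3 F.L, Kop := knitOp166 F.L μ ν a b, Ksite := knitSite163 F.L μ' lam,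
          Kunit := covOpKernels F.L α β, inΛ := inAll F.L, unitDist := rhoDist F.L } := fun _ _ _ _ _ _ => rfl
  refine ⟨𝔯, h𝔯, fun F θ hP g₀ os k => ?_,
    s_N15_of_admits_knit_family (fun {F D} (h : IsDatumOfRecord₁₃CCoPH F N D) g₀ os k =>
      (𝔯.lit F h.params h.provisos g₀ os).ne2 k) (RRec₁₃CoPH 𝔯) hμν a b μ' lam α β c35 p
      (admits_rRec₁₃CoPH_ne2 𝔯) fun F D hD g₀ os k => h𝔯 F hD.params hD.provisos g₀ os k⟩
  rw [h𝔯 F θ hP g₀ os k]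
  haveI := neZero_blockFactor F
  exact populated_knitObjects F.L μ ν a b μ' lam α β c35 p

/-- **A READING WITH THE RATE-LESS OPERATOR FAMILY AT SOME STAGE-13 DATUM OF RECORD HAS NO `S_N15 (RRec₁₃CoPH 𝔯)`** [decided toy]: if at the canonical parameter of some
Stage-13 datum of record, some `(g₀, os, k)`, the reading's NE2 objects carry, on the knit carriers `knitInstance 3 2`, the RATE-LESS operator family `X_N k ≡ 2^k`
— whatever `c35`, `p` and the site ∕ unit kernels —, the stub at the home FAILS (file 1's key-free `not_s_N15_of_pins_rateless` at layer B's `rRec₁₃CoPH_self`).  Such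
objects ARE `Populated`: the display is necessary, never sufficient; N15's content at the home is a genuine RATE of the pinned operator family. [bookkeeping] -/
theorem not_s_N15_rRec₁₃CoPH_of_ratelessReading (𝔯 : RateReading₁₃CoPH N) {F : T4Family} {D : Datum F N} (hD : IsDatumOfRecord₁₃CCoPH F N D) (g₀ : ℕ → ℝ)
    (os : List (ULoop F)) (k : ℕ) (c35 p : ℝ) (μ' lam α β : Fin 4)
    (h : (𝔯.lit F hD.params hD.provisos g₀ os).ne2 k =
      { I := KnitIndex 3 2, c35 := c35, p := p, pi := knitInstance 3 2, Kop := knitOp 2 (fun _ _ k _ => (2 : ℝ) ^ k),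
        Ksite := knitSite163 2 μ' lam, Kunit := covOpKernels 2 α β, inΛ := inAll 2, unitDist := rhoDist 2 }) :
    ¬ S_N15 (RRec₁₃CoPH 𝔯) :=
  AtKeyedHome.not_s_N15_of_pins_rateless (RRec₁₃CoPH 𝔯) (YMDAG.UVSplit.rRec₁₃CoPH_self 𝔯 hD g₀ os k) c35 p μ' lam α β (by rw [rateCarriersOfRecord₁₃CoPH_ne2, h])

/-- **GIVEN A STAGE-13 DATUM OF RECORD, SOME READING REFUTES THE STUB AT THE HOME** [decided toy] (the hypothesis is the datum shadow of K0⁷ `Record13SepCoPHInhabited` at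
rank `N`): the constant reading at the rate-less family on the knit carriers. [bookkeeping] -/
theorem exists_reading_not_s_N15_rRec₁₃CoPH (hex : ∃ (F : T4Family) (D : Datum F N), IsDatumOfRecord₁₃CCoPH F N D) :
    ∃ 𝔯 : RateReading₁₃CoPH N, ¬ S_N15 (RRec₁₃CoPH 𝔯) := by
  obtain ⟨F, D, hD⟩ := hex
  obtain ⟨𝔯, h𝔯⟩ := exists_reading₁₃CoPH_ne2_const (N := N)
    { I := KnitIndex 3 2, c35 := 0, p := 0, pi := knitInstance 3 2, Kop := knitOp 2 (fun _ _ k _ => (2 : ℝ) ^ k),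
      Ksite := knitSite163 2 0 0, Kunit := covOpKernels 2 0 0, inΛ := inAll 2, unitDist := rhoDist 2 }
  exact ⟨𝔯, not_s_N15_rRec₁₃CoPH_of_ratelessReading 𝔯 hD (fun _ => 0) [] 0 0 0 0 0 0 0 (h𝔯 F hD.params hD.provisos (fun _ => 0) [] 0)⟩

/-- **SUMMARY — THE STUB AT THE STAGE-13 HOME IS DECIDED BY THE PIN** [decided toy]: some populated reading closes `S_N15 (RRec₁₃CoPH ·)` with genuine rates, and — as soon
as a Stage-13 datum of record exists at rank `N` (K0⁷'s shadow) — some populated reading refutes it.  `S_N15 (RRec₁₃CoPH 𝔯)` is a statement ABOUT `𝔯.lit · ne2`.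
[bookkeeping] -/
theorem s_N15_rRec₁₃CoPH_decided_by_pin (hex : ∃ (F : T4Family) (D : Datum F N), IsDatumOfRecord₁₃CCoPH F N D) :
    (∃ 𝔯 : RateReading₁₃CoPH N, S_N15 (RRec₁₃CoPH 𝔯)) ∧ (∃ 𝔯 : RateReading₁₃CoPH N, ¬ S_N15 (RRec₁₃CoPH 𝔯)) := by
  obtain ⟨𝔯, -, -, h𝔯⟩ := exists_reading_s_N15_rRec₁₃CoPH_knit (N := N) 2 le_rfl (show (0 : Fin 4) ≠ 1 by decide) 0 0 0 0 0 0 0 0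
  exact ⟨⟨𝔯, h𝔯⟩, exists_reading_not_s_N15_rRec₁₃CoPH hex⟩

/-! ## §4 Component locality at the Stage-13 home: N15 reads ONLY the pin of `𝔯.lit · ne2` -/

/-- **COMPONENT LOCALITY — `S_N15 (RRec₁₃CoPH ·)` TRANSFERS ALONG READINGS WHOSE NE2 OBJECTS AGREE ON THE ADMISSIBLE TUPLES WITH PROVISOS** [bookkeeping]: if `𝔯'`'s
level-`k` NE2 objects coincide with `𝔯`'s at every `θ : Stage13HParams F N` with provisos `hP` and `θ.Admissible F N` (every family, `(g₀, os)`, run length), then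
`S_N15 (RRec₁₃CoPH 𝔯)` gives `S_N15 (RRec₁₃CoPH 𝔯')` — whatever the two readings' dressed towers `ne1`, NE3 letters `ne3` and U3 objects `u3` are (file 1's
`s_N15_of_admits_attains_ne2_agree` at the two certificates; layer B's `rRec₁₃CoPH_congr` restricted to ONE component).  W1's history terms, N16's letters and NODE O's
dressed tower are idle for N15 at the home. -/
theorem s_N15_rRec₁₃CoPH_of_ne2_agree {𝔯 𝔯' : RateReading₁₃CoPH N}
    (h : ∀ (F : T4Family) (θ : Stage13HParams F N) (hP : θ.Provisos₁₃CoPH F N), θ.Admissible F N → ∀ (g₀ : ℕ → ℝ) (os : List (ULoop F)) (k : ℕ),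
      (𝔯'.lit F θ hP g₀ os).ne2 k = (𝔯.lit F θ hP g₀ os).ne2 k)
    (hS : S_N15 (RRec₁₃CoPH 𝔯)) : S_N15 (RRec₁₃CoPH 𝔯') :=
  s_N15_of_admits_attains_ne2_agree (fun {F D} (h : IsDatumOfRecord₁₃CCoPH F N D) g₀ os k =>
      (𝔯.lit F h.params h.provisos g₀ os).ne2 k)
    (fun {F D} (h : IsDatumOfRecord₁₃CCoPH F N D) g₀ os k =>
      (𝔯'.lit F h.params h.provisos g₀ os).ne2 k) (RRec₁₃CoPH 𝔯) (RRec₁₃CoPH 𝔯') (attains_rRec₁₃CoPH_ne2 𝔯) (admits_rRec₁₃CoPH_ne2 𝔯')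
    (fun F _ hD g₀ os k => h F hD.params hD.provisos hD.admissible g₀ os k) hS

/-- **… hence readings with the same `ne2` pin on the admissible tuples with provisos have THE SAME `S_N15` at the home** [bookkeeping]. -/
theorem s_N15_rRec₁₃CoPH_iff_of_ne2_agree {𝔯 𝔯' : RateReading₁₃CoPH N}
    (h : ∀ (F : T4Family) (θ : Stage13HParams F N) (hP : θ.Provisos₁₃CoPH F N), θ.Admissible F N → ∀ (g₀ : ℕ → ℝ) (os : List (ULoop F)) (k : ℕ),
      (𝔯.lit F θ hP g₀ os).ne2 k = (𝔯'.lit F θ hP g₀ os).ne2 k) :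
    S_N15 (RRec₁₃CoPH 𝔯) ↔ S_N15 (RRec₁₃CoPH 𝔯') :=
  ⟨s_N15_rRec₁₃CoPH_of_ne2_agree fun F θ hP hA g₀ os k => (h F θ hP hA g₀ os k).symm,
    s_N15_rRec₁₃CoPH_of_ne2_agree fun F θ hP hA g₀ os k => h F θ hP hA g₀ os k⟩

/-- **THE PIN AS ONE POINTWISE EQUATION** [bookkeeping]: if a reading's `ne2` component agrees, on the admissible tuples with provisos, with a NAMED assignment
`pin : (F : T4Family) → (θ : Stage13HParams F N) → θ.Provisos₁₃CoPH F N → (ℕ → ℝ) → List (ULoop F) → ℕ → NE2Objects₁₁` carrying the three NE2⁺ layers (`N15At`) at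
every admissible tuple, then `S_N15 (RRec₁₃CoPH 𝔯)` — the shape in which a definer's N15 pin and an estimate seat's ∀θ-theorem about `pin` meet at the home. -/
theorem s_N15_rRec₁₃CoPH_of_pin (𝔯 : RateReading₁₃CoPH N)
    (pin : (F : T4Family) → (θ : Stage13HParams F N) → θ.Provisos₁₃CoPH F N → (ℕ → ℝ) → List (ULoop F) → ℕ → NE2Objects₁₁)
    (hpin : ∀ (F : T4Family) (θ : Stage13HParams F N) (hP : θ.Provisos₁₃CoPH F N), θ.Admissible F N → ∀ (g₀ : ℕ → ℝ) (os : List (ULoop F)) (k : ℕ),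
      (𝔯.lit F θ hP g₀ os).ne2 k = pin F θ hP g₀ os k)
    (hest : ∀ (F : T4Family) (θ : Stage13HParams F N) (hP : θ.Provisos₁₃CoPH F N), θ.Admissible F N → ∀ (g₀ : ℕ → ℝ) (os : List (ULoop F)) (k : ℕ),
      N15At (ne2OfRecord₁₁ (pin F θ hP g₀ os k))) :
    S_N15 (RRec₁₃CoPH 𝔯) :=
  s_N15_rRec₁₃CoPH_of_forall_admissible 𝔯 fun F θ hP hA g₀ os k => by
    rw [hpin F θ hP hA g₀ os k]
    exact hest F θ hP hA g₀ os k


end Summit.QuantumFields.YangMills.BalabanUVNodes.N15.AtRRec13CoPH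

end
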